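import Mathlib
import Literature.Analysis.FluidPDE.VectorCalculus
import Summits.NavierStokesRegularity.NavierStokesRegularity.Theorems.FilamentSkeletonRssSkeletonEquilibriumSymmetryRigidity

/-!
# `SkeletonEquilibrium` (stmt-NavierStokesRegularity-15400): the remaining ℤ₂ class (κ = +1, s₀s₁ = −1) — filaments on coaxial cylinders

Negative-side structural helper for the (held) support item `FilamentSkeletonRss.SkeletonEquilibrium`
(`--supports stmt-NavierStokesRegularity-15400`): the fourth line of the ℤ₂-symmetry table of
`…SymmetryRigidity` (p831234). There, for the symmetry datum `Ξ_{πk}(εσ)ᵢ = sᵢ Ξ_k(σ)ᵢ + cᵢ` (diagonal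
`M = diag(s)`, vertical translation `c = (0,0,c₂)`, orientation sign `ε`, involutive relabelling `π`, `γ ∘ π = γ`)
the sign `κ = ε s₀s₁s₂` and `s₀s₁` decide: `κ = −1` ⇒ rigid (`N ≤ 1`), `κ = 1 ∧ s₀s₁ = 1` ⇒ compatible (slip law).
Here: `κ = 1 ∧ s₀s₁ = −1` — the HORIZONTAL HALF-TURN WITH ORIENTATIONS PRESERVED (`s = (1,−1,−1)`, `ε = 1`) and
the VERTICAL MIRROR WITH ORIENTATIONS REVERSED (`s = (1,−1,1)`, `ε = −1`; the classical counter-rotating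
«image-vortex» pair of a filament and its mirror image).

* `azimuthal_law` — the transport identity degenerates to `λ Ξ_k′ = 2α e₃ × Ξ_k + ½ s₂c₂ e₃`
  (`λ = ε w_{πk}(ετ) − w_k τ`): tangents are azimuthal plus a vertical drift.
* `radius_const_of_azimuthal` — ★ hence (for `α ≠ 0`) the horizontal radius is CONSTANT along every filament:
  `(Ξ_k τ)₀² + (Ξ_k τ)₁² = (Ξ_k 0)₀² + (Ξ_k 0)₁²` — every filament lies on a vertical cylinder coaxial with the
  rotation axis (so, being proper, it winds helically up the cylinder; cf. `…HelixExclusion`).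
* `on_axis_of_azimuthal` — ★ if moreover the symmetry fixes the origin (`c₂ = 0`: half-turn about a horizontal
  line THROUGH THE ORIGIN preserved, or a vertical mirror with reversal), every filament lies ON THE AXIS
  (`(Ξ_k τ)₀ = (Ξ_k τ)₁ = 0` for all `τ`): off the axis `λ ≠ 0` forces `Ξ_k′ ⊥ e₃`, so `z` would be constant and
  the filament bounded, contradicting properness. (With the separation and injectivity clauses this leaves no
  witness at all in these classes; that last bookkeeping step is not typed here.)

Mathlib + `Literature.Analysis.FluidPDE.VectorCalculus` + `…SymmetryRigidity` (`transport_identity`).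
-/

-- `NavierStokesRegularity.NavierStokesRegularity` is the summit/problem path (D-0017), flagged by dupNamespace.
set_option linter.dupNamespace false

namespace Summit.NavierStokesRegularity.NavierStokesRegularity.Theorems.SkeletonEquilibrium.SymmetryAzimuthal

open Literature.Analysis.FluidPDE MeasureTheory Filter
open scoped RealInnerProductSpace InnerProductSpace BigOperators Topology
open Summit.NavierStokesRegularity.NavierStokesRegularity.Theorems.SkeletonEquilibrium.SymmetryRigidity
  (transport_identity)

/-- The coordinate functions of a differentiable curve in `ℝ³` are differentiable with derivative the
coordinate of the velocity. [folklore] -/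
private theorem hasDerivAt_apply {X : ℝ → EuclideanSpace ℝ (Fin 3)} (hd : Differentiable ℝ X)
    (i : Fin 3) (σ : ℝ) : HasDerivAt (fun σ' => X σ' i) (deriv X σ i) σ := by
  have h := ((EuclideanSpace.proj i : EuclideanSpace ℝ (Fin 3) →L[ℝ] ℝ).hasFDerivAt).comp_hasDerivAt σ
    (hd σ).hasDerivAt
  exact h

/-- ‖·‖² of a vector of `ℝ³` in coordinates. [folklore] -/
private theorem norm_sq_fin3 (v : EuclideanSpace ℝ (Fin 3)) : ‖v‖ ^ 2 = v 0 ^ 2 + v 1 ^ 2 + v 2 ^ 2 := by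
  rw [EuclideanSpace.norm_sq_eq]
  simp [Fin.sum_univ_three, Real.norm_eq_abs, sq_abs]

section Azimuthal

variable {N : ℕ} {Ξ : Fin N → ℝ → EuclideanSpace ℝ (Fin 3)} {π : Fin N → Fin N} {s c : Fin 3 → ℝ} {ε : ℝ}
  (hd : ∀ k, Differentiable ℝ (Ξ k)) (hs : ∀ i, s i * s i = 1) (hε : ε * ε = 1)
  (hsym : ∀ k σ i, Ξ (π k) (ε * σ) i = s i * Ξ k σ i + c i)
  (hπ : ∀ k, π (π k) = k) (γ : Fin N → ℝ) (hγ : ∀ k, γ (π k) = γ k)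
  (hc : c 0 = 0 ∧ c 1 = 0) (hκ : ε * (s 0 * s 1 * s 2) = 1) (hs01 : s 0 * s 1 = -1) (Γ α : ℝ)
  (w : Fin N → ℝ → ℝ)
  (hint : ∀ k (x : EuclideanSpace ℝ (Fin 3)), Integrable (fun σ : ℝ =>
    ((‖x - Ξ k σ‖ ^ 2 + 1) ^ (3 / 2 : ℝ))⁻¹ • cross (deriv (Ξ k) σ) (x - Ξ k σ)))
  (heq : ∀ k τ, (∑ m : Fin N, (Γ * γ m / (4 * Real.pi)) • ∫ σ : ℝ,
      ((‖Ξ k τ - Ξ m σ‖ ^ 2 + 1) ^ (3 / 2 : ℝ))⁻¹ • cross (deriv (Ξ m) σ) (Ξ k τ - Ξ m σ)) +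
      (1 / 2 : ℝ) • Ξ k τ - α • cross (EuclideanSpace.single (2 : Fin 3) (1 : ℝ)) (Ξ k τ) =
      w k τ • deriv (Ξ k) τ)
include hd hs hε hsym hπ hγ hc hκ hs01 hint heq

/-- **Azimuthal law** (`κ = 1`, `s₀s₁ = −1`): `−2α y₁ = λ t₀`, `2α y₀ = λ t₁`, `½ s₂c₂ = λ t₂` with
`λ = ε w_{πk}(ετ) − w_k τ`, `y = Ξ_k τ`, `t = Ξ_k′ τ`. [folklore] -/
theorem azimuthal_law (k : Fin N) (τ : ℝ) :
    -(2 * α) * Ξ k τ 1 = (ε * w (π k) (ε * τ) - w k τ) * deriv (Ξ k) τ 0 ∧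
      2 * α * Ξ k τ 0 = (ε * w (π k) (ε * τ) - w k τ) * deriv (Ξ k) τ 1 ∧
      1 / 2 * s 2 * c 2 = (ε * w (π k) (ε * τ) - w k τ) * deriv (Ξ k) τ 2 := by
  obtain ⟨h0, h1, h2⟩ := transport_identity hd hs hε hsym hπ γ hγ hc Γ α w hint heq k τ
  rw [hκ] at h0 h1 h2
  rw [hs01] at h0 h1
  refine ⟨?_, ?_, ?_⟩
  · linear_combination h0
  · linear_combination h1
  · linear_combination h2

/-- ★ **Coaxial cylinders.** For `α ≠ 0` the horizontal radius is constant along every filament: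
`(Ξ_k τ)₀² + (Ξ_k τ)₁² = (Ξ_k 0)₀² + (Ξ_k 0)₁²`. (The azimuthal law gives `λ⟪y_h, t_h⟫ = 0`, and `λ = 0` forces
`y_h = 0`; either way `d/dτ ‖y_h‖² = 0`.) [folklore] -/
theorem radius_const_of_azimuthal (hα : α ≠ 0) (k : Fin N) (τ : ℝ) :
    Ξ k τ 0 ^ 2 + Ξ k τ 1 ^ 2 = Ξ k 0 0 ^ 2 + Ξ k 0 1 ^ 2 := by
  set g : ℝ → ℝ := fun σ => Ξ k σ 0 ^ 2 + Ξ k σ 1 ^ 2 with hg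
  have hgd : ∀ σ, HasDerivAt g (2 * Ξ k σ 0 * deriv (Ξ k) σ 0 + 2 * Ξ k σ 1 * deriv (Ξ k) σ 1) σ := by
    intro σ
    have h0 := (hasDerivAt_apply (hd k) 0 σ).pow 2
    have h1 := (hasDerivAt_apply (hd k) 1 σ).pow 2
    have h := h0.add h1
    refine h.congr_deriv ?_
    simp only [Nat.cast_ofNat]
    ring
  have hzero : ∀ σ, 2 * Ξ k σ 0 * deriv (Ξ k) σ 0 + 2 * Ξ k σ 1 * deriv (Ξ k) σ 1 = 0 := by
    intro σ
    obtain ⟨a0, a1, _⟩ := azimuthal_law hd hs hε hsym hπ γ hγ hc hκ hs01 Γ α w hint heq k σ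
    set lam := ε * w (π k) (ε * σ) - w k σ with hlam
    by_cases hl : lam = 0
    · rw [hl, zero_mul] at a0 a1
      have hy1 : Ξ k σ 1 = 0 := by
        have : -(2 * α) * Ξ k σ 1 = 0 := a0
        rcases mul_eq_zero.mp this with h | h
        · exact absurd (by linarith : α = 0) hα
        · exact h
      have hy0 : Ξ k σ 0 = 0 := by
        have : 2 * α * Ξ k σ 0 = 0 := a1
        rcases mul_eq_zero.mp this with h | h
        · exact absurd (by linarith : α = 0) hα
        · exact h
      rw [hy0, hy1]; ring
    · -- λ·(y₀t₀ + y₁t₁) = (−2α y₁ y₀ + 2α y₀ y₁)/… = 0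
      have hprod : lam * (2 * Ξ k σ 0 * deriv (Ξ k) σ 0 + 2 * Ξ k σ 1 * deriv (Ξ k) σ 1) = 0 := by
        linear_combination -(2 * Ξ k σ 0) * a0 - (2 * Ξ k σ 1) * a1
      rcases mul_eq_zero.mp hprod with h | h
      · exact absurd h hl
      · exact h
  have hdiff : Differentiable ℝ g := fun σ => (hgd σ).differentiableAt
  have hderiv : ∀ σ, deriv g σ = 0 := fun σ => by rw [(hgd σ).deriv, hzero σ]
  exact is_const_of_deriv_eq_zero hdiff hderiv τ 0

/-- ★ **Through-the-origin classes collapse to the axis.** If the symmetry fixes the origin (`c₂ = 0`) and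
`α ≠ 0`, every (proper) filament lies on the rotation axis: `(Ξ_k τ)₀ = (Ξ_k τ)₁ = 0` for all `τ`. [folklore] -/
theorem on_axis_of_azimuthal (hα : α ≠ 0) (hc2 : c 2 = 0)
    (hprop : ∀ k, Tendsto (fun τ => ‖Ξ k τ‖) atTop atTop) (k : Fin N) (τ : ℝ) :
    Ξ k τ 0 = 0 ∧ Ξ k τ 1 = 0 := by
  -- the constant squared radius
  set r : ℝ := Ξ k 0 0 ^ 2 + Ξ k 0 1 ^ 2 with hr
  have hrad : ∀ σ, Ξ k σ 0 ^ 2 + Ξ k σ 1 ^ 2 = r :=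
    fun σ => radius_const_of_azimuthal hd hs hε hsym hπ γ hγ hc hκ hs01 Γ α w hint heq hα k σ
  by_cases hr0 : r = 0
  · have h := hrad τ
    rw [hr0] at h
    constructor <;> nlinarith [sq_nonneg (Ξ k τ 0), sq_nonneg (Ξ k τ 1)]
  · -- off the axis everywhere: λ ≠ 0, hence t₂ = 0, z constant, ‖Ξ‖ constant: contradiction
    exfalso
    have hrpos : 0 < r := lt_of_le_of_ne (by positivity) (Ne.symm hr0)
    have ht2 : ∀ σ, deriv (Ξ k) σ 2 = 0 := by
      intro σ
      obtain ⟨a0, a1, a2⟩ := azimuthal_law hd hs hε hsym hπ γ hγ hc hκ hs01 Γ α w hint heq k σ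
      rw [hc2, mul_zero] at a2
      set lam := ε * w (π k) (ε * σ) - w k σ with hlam
      have hl : lam ≠ 0 := by
        intro hl
        rw [hl, zero_mul] at a0 a1
        have hy1 : Ξ k σ 1 = 0 := by
          rcases mul_eq_zero.mp (a0 : -(2 * α) * Ξ k σ 1 = 0) with h | h
          · exact absurd (by linarith : α = 0) hα
          · exact h
        have hy0 : Ξ k σ 0 = 0 := by
          rcases mul_eq_zero.mp (a1 : 2 * α * Ξ k σ 0 = 0) with h | h
          · exact absurd (by linarith : α = 0) hα
          · exact h
        have := hrad σ
        rw [hy0, hy1] at this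
        apply hr0; nlinarith
      rcases mul_eq_zero.mp a2.symm with h | h
      · exact absurd h hl
      · exact h
    -- z is constant
    have hz : ∀ σ, Ξ k σ 2 = Ξ k 0 2 := by
      intro σ
      have hdiff : Differentiable ℝ (fun σ' => Ξ k σ' 2) := fun σ' => (hasDerivAt_apply (hd k) 2 σ').differentiableAt
      exact is_const_of_deriv_eq_zero hdiff (fun σ' => by rw [(hasDerivAt_apply (hd k) 2 σ').deriv, ht2 σ'])
        σ 0
    -- ‖Ξ k σ‖² is constant, contradicting properness
    have hnorm : ∀ σ, ‖Ξ k σ‖ ^ 2 = r + Ξ k 0 2 ^ 2 := by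
      intro σ; rw [norm_sq_fin3, hz σ, ← hrad σ]
    have hbound : ∀ σ, ‖Ξ k σ‖ ≤ Real.sqrt (r + Ξ k 0 2 ^ 2) := by
      intro σ
      rw [← Real.sqrt_sq (norm_nonneg (Ξ k σ)), hnorm σ]
    have h := (hprop k).eventually (eventually_gt_atTop (Real.sqrt (r + Ξ k 0 2 ^ 2)))
    obtain ⟨σ, hσ⟩ := h.exists
    exact absurd (hbound σ) (not_le.mpr hσ)

end Azimuthal

/-! ### Appendix (append-only extension): the through-origin azimuthal classes admit no witness at all

With the injectivity, properness and separation clauses of the crux, the conclusion of `on_axis_of_azimuthal`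
(every filament on the axis) is absurd for `N ≥ 1`: a proper injective filament on the axis covers the whole axis
(`axis_filament_surjective`), so two of them meet (separation), and a single one contradicts its own symmetry
(`ε s₂ = −1` forces `z(εσ) = s₂ z(σ)`, incompatible with injectivity). -/

/-- A continuous real function with `|f| → ∞` at both ends which is strictly monotone tends to `+∞` at `+∞` and
to `−∞` at `−∞`. [folklore] -/
private theorem tendsto_of_strictMono_abs {f : ℝ → ℝ} (hm : StrictMono f)
    (htop : Tendsto (fun τ => |f τ|) atTop atTop) (hbot : Tendsto (fun τ => |f τ|) atBot atTop) :
    Tendsto f atTop atTop ∧ Tendsto f atBot atBot := by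
  constructor
  · have h1 : Tendsto (fun τ => |f τ| - 2 * |f 0|) atTop atTop := tendsto_atTop_add_const_right _ _ htop
    refine tendsto_atTop_mono' atTop ?_ h1
    filter_upwards [eventually_ge_atTop (0 : ℝ)] with τ hτ
    have hf0 : f 0 ≤ f τ := hm.monotone hτ
    rcases le_or_gt 0 (f τ) with h | h
    · rw [abs_of_nonneg h]; linarith [abs_nonneg (f 0)]
    · rw [abs_of_neg h]; linarith [neg_abs_le (f 0)]
  · have h1 : Tendsto (fun τ => -(|f τ| - 2 * |f 0|)) atBot atBot :=
      tendsto_neg_atTop_atBot.comp (tendsto_atTop_add_const_right _ _ hbot)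
    refine tendsto_atBot_mono' atBot ?_ h1
    filter_upwards [eventually_le_atBot (0 : ℝ)] with τ hτ
    have hf0 : f τ ≤ f 0 := hm.monotone hτ
    rcases le_or_gt 0 (f τ) with h | h
    · rw [abs_of_nonneg h]; linarith [le_abs_self (f 0)]
    · rw [abs_of_neg h]; linarith [abs_nonneg (f 0)]

/-- **A proper injective continuous filament lying on the axis covers the axis**: for every height `z` there is
a parameter with `(Ξ τ)₂ = z`. [folklore] -/
theorem axis_filament_surjective {X : ℝ → EuclideanSpace ℝ (Fin 3)} (hc : Continuous X)
    (hinj : Function.Injective X) (haxis : ∀ τ, X τ 0 = 0 ∧ X τ 1 = 0)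
    (hprop : Tendsto (fun τ => ‖X τ‖) atTop atTop ∧ Tendsto (fun τ => ‖X τ‖) atBot atTop) (z : ℝ) :
    ∃ τ, X τ 2 = z := by
  set f : ℝ → ℝ := fun τ => X τ 2 with hf
  have hfc : Continuous f := by
    have h := ((EuclideanSpace.proj (2 : Fin 3) : EuclideanSpace ℝ (Fin 3) →L[ℝ] ℝ).continuous).comp hc
    exact h
  have hfinj : Function.Injective f := by
    intro a b hab
    apply hinj
    ext i
    fin_cases i
    · simp [(haxis a).1, (haxis b).1]
    · simp [(haxis a).2, (haxis b).2]
    · simpa [hf] using hab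
  have habs : ∀ τ, |f τ| = ‖X τ‖ := by
    intro τ
    have h := norm_sq_fin3 (X τ)
    rw [(haxis τ).1, (haxis τ).2] at h
    have h2 : ‖X τ‖ ^ 2 = (f τ) ^ 2 := by rw [h, hf]; ring
    have := abs_eq_abs.mpr (Or.inl rfl : f τ = f τ ∨ f τ = -f τ)
    rw [← Real.sqrt_sq (norm_nonneg (X τ)), h2, Real.sqrt_sq_eq_abs]
  have htop : Tendsto (fun τ => |f τ|) atTop atTop := hprop.1.congr fun τ => (habs τ).symm
  have hbot : Tendsto (fun τ => |f τ|) atBot atTop := hprop.2.congr fun τ => (habs τ).symm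
  rcases hfc.strictMono_of_inj hfinj with hm | ha
  · obtain ⟨h1, h2⟩ := tendsto_of_strictMono_abs hm htop hbot
    exact hfc.surjective h1 h2 z
  · -- strictly antitone: apply the monotone case to `-f`
    have hm : StrictMono (fun τ => -f τ) := fun a b hab => neg_lt_neg (ha hab)
    have htop' : Tendsto (fun τ => |-f τ|) atTop atTop := by simpa only [abs_neg] using htop
    have hbot' : Tendsto (fun τ => |-f τ|) atBot atTop := by simpa only [abs_neg] using hbot
    obtain ⟨h1, h2⟩ := tendsto_of_strictMono_abs hm htop' hbot'
    obtain ⟨τ, hτ⟩ := hfc.neg.surjective h1 h2 (-z)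
    exact ⟨τ, by simpa using hτ⟩

section AzimuthalExclusion

variable {N : ℕ} {Ξ : Fin N → ℝ → EuclideanSpace ℝ (Fin 3)} {π : Fin N → Fin N} {s c : Fin 3 → ℝ} {ε : ℝ}
  (hd : ∀ k, Differentiable ℝ (Ξ k)) (hs : ∀ i, s i * s i = 1) (hε : ε * ε = 1)
  (hsym : ∀ k σ i, Ξ (π k) (ε * σ) i = s i * Ξ k σ i + c i)
  (hπ : ∀ k, π (π k) = k) (γ : Fin N → ℝ) (hγ : ∀ k, γ (π k) = γ k)
  (hc : c 0 = 0 ∧ c 1 = 0) (hκ : ε * (s 0 * s 1 * s 2) = 1) (hs01 : s 0 * s 1 = -1) (Γ α : ℝ)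
  (w : Fin N → ℝ → ℝ)
  (hint : ∀ k (x : EuclideanSpace ℝ (Fin 3)), Integrable (fun σ : ℝ =>
    ((‖x - Ξ k σ‖ ^ 2 + 1) ^ (3 / 2 : ℝ))⁻¹ • cross (deriv (Ξ k) σ) (x - Ξ k σ)))
  (heq : ∀ k τ, (∑ m : Fin N, (Γ * γ m / (4 * Real.pi)) • ∫ σ : ℝ,
      ((‖Ξ k τ - Ξ m σ‖ ^ 2 + 1) ^ (3 / 2 : ℝ))⁻¹ • cross (deriv (Ξ m) σ) (Ξ k τ - Ξ m σ)) +
      (1 / 2 : ℝ) • Ξ k τ - α • cross (EuclideanSpace.single (2 : Fin 3) (1 : ℝ)) (Ξ k τ) =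
      w k τ • deriv (Ξ k) τ)
include hd hs hε hsym hπ hγ hc hκ hs01 hint heq

/-- ★ **No witness in the through-origin azimuthal classes.** With `α ≠ 0`, `c = 0`, and the injectivity,
properness and separation (`0 < d`) clauses of the crux, a `κ = +1, s₀s₁ = −1`-symmetric relative equilibrium has
NO filament: `N = 0`. (All filaments lie on the axis and cover it; two would meet; a single one satisfies
`z(εσ) = s₂ z(σ)` with `ε s₂ = −1`, contradicting injectivity.) In particular image-vortex pairs (vertical mirror,
orientations reversed) and configurations symmetric under a half-turn about a horizontal line through the origin
with orientations preserved are never witnesses of `SkeletonEquilibrium`. [folklore] -/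
theorem card_eq_zero_of_azimuthal_origin (hα : α ≠ 0) (hc2 : c 2 = 0) (d : ℝ) (hdpos : 0 < d)
    (hinj : ∀ k, Function.Injective (Ξ k))
    (hprop : ∀ k, Tendsto (fun τ => ‖Ξ k τ‖) atTop atTop ∧ Tendsto (fun τ => ‖Ξ k τ‖) atBot atTop)
    (hsep : ∀ k m, k ≠ m → ∀ τ σ, d ≤ ‖Ξ k τ - Ξ m σ‖) : N = 0 := by
  have haxis : ∀ k τ, Ξ k τ 0 = 0 ∧ Ξ k τ 1 = 0 := fun k τ =>
    on_axis_of_azimuthal hd hs hε hsym hπ γ hγ hc hκ hs01 Γ α w hint heq hα hc2 (fun k => (hprop k).1) k τ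
  rcases Nat.eq_zero_or_pos N with h0 | hpos
  · exact h0
  exfalso
  set k : Fin N := ⟨0, hpos⟩ with hk
  by_cases hself : π k = k
  · -- a single symmetric filament on the axis contradicts injectivity
    have hz : ∀ σ, Ξ k (ε * σ) 2 = s 2 * Ξ k σ 2 := by
      intro σ; have h := hsym k σ 2; rw [hself, hc2, add_zero] at h; exact h
    have hεs : ε * s 2 = -1 := by
      have h1 : ε * (s 0 * s 1 * s 2) = ε * s 2 * (s 0 * s 1) := by ring
      rw [h1, hs01] at hκ; linarith
    have hpt : ∀ σ σ', Ξ k σ 2 = Ξ k σ' 2 → σ = σ' := by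
      intro σ σ' hz2
      apply hinj k
      ext i
      fin_cases i
      · simp [(haxis k σ).1, (haxis k σ').1]
      · simp [(haxis k σ).2, (haxis k σ').2]
      · simpa using hz2
    rcases mul_self_eq_one_iff.mp hε with h1 | h1
    · -- ε = 1, s₂ = −1: z ≡ 0
      have hs2 : s 2 = -1 := by rw [h1, one_mul] at hεs; exact hεs
      have hz0 : ∀ σ, Ξ k σ 2 = 0 := by
        intro σ; have h := hz σ; rw [h1, one_mul, hs2] at h; linarith
      have := hpt 0 1 (by rw [hz0, hz0])
      norm_num at this
    · -- ε = −1, s₂ = 1: z even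
      have hs2 : s 2 = 1 := by rw [h1] at hεs; linarith
      have h := hz 1
      rw [h1, hs2, one_mul, show (-1 : ℝ) * 1 = -1 by norm_num] at h
      have := hpt (-1) 1 h
      norm_num at this
  · -- two distinct filaments on the axis meet
    obtain ⟨τ, hτ⟩ := axis_filament_surjective (hd (π k)).continuous (hinj (π k)) (haxis (π k)) (hprop (π k))
      (Ξ k 0 2)
    have hpt : Ξ (π k) τ = Ξ k 0 := by
      ext i
      fin_cases i
      · simp [(haxis (π k) τ).1, (haxis k 0).1]
      · simp [(haxis (π k) τ).2, (haxis k 0).2]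
      · simpa using hτ
    have h := hsep (π k) k hself τ 0
    rw [hpt, sub_self, norm_zero] at h
    linarith

end AzimuthalExclusion

end Summit.NavierStokesRegularity.NavierStokesRegularity.Theorems.SkeletonEquilibrium.SymmetryAzimuthal
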